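import Mathlib
import Summits.Ventures.PercRepro2.KPrimeCycle
import Summits.Ventures.PercRepro2.KPrimeTCycle
import Summits.Ventures.PercRepro2.KPrimePendantT
import Summits.Ventures.PercRepro2.KPrimeNecklace

/-!
# Hanging `v` on a leaf: `(K′)` on a cycle or a necklace with `v` pendant at an unmarked vertex
(blind cell PercRepro2, mine-c g41; `conjectures/MINE-C.md` §50.4)

The leaf extension `leafExt ends z` of a graph `ends : E → Sym2 V` at the vertex `z` adds one
vertex `inr ()` and one edge `inr ()` joining it to `inl z` (vertices `V ⊕ Unit`, edges
`E ⊕ Unit`).  Two generic facts: the leaf changes no connectivity among the old vertices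
(`conn_leafExt_iff`, by the closure lemma `mem_of_conn_of_closed` in both directions), and the
law of the old edges is the marginal of the product law (`prob_comp_inl`).  So every statement of
the form «`KPrimeHolds`/`KPrimeTHolds` at marks of `V`» transports from `ends` to `leafExt ends z`
(`kprimeHolds_leafExt`, `kprimeTHolds_leafExt`), and mine-c g34's improved pendant step
`kprime_of_pendant_T` — `(K′)_z ∧ (K′-T)_z ⟹ (K′)_v` for `v` a leaf at `z` — gives:

* **`kprime_leafExt`**: if `(K′)` and `(K′-T)` hold on `ends` at `(a₁, a₂, b, z, y)` for the
  weights of the old edges, then `(K′)` holds on `leafExt ends z` at `(a₁, a₂, b, v, y)`,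
  `v = inr ()`, for every admissible weight vector (the leaf edge's weight `≠ 1`, the three masses
  of the `z`-instance positive);
* **`kprime_cycle_leaf`** / **`kprime_necklace_leaf`**: `(K′)` on every cycle, resp. necklace, with
  `v` hung by a leaf edge on an unmarked vertex `z` — the first family on which the
  `v`-exploration frame of g33–g34 closes.
-/

namespace Summit.Ventures.PercRepro2

namespace KPrimeCycle

open Cycle

/-! ## The marginal of a product law -/

section Marginal

variable {E : Type*} {F : Type*} [Fintype E] [DecidableEq E] [Fintype F] [DecidableEq F]
  {R : Type*} [CommRing R]

omit [DecidableEq E] [DecidableEq F] in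
/-- The weight of a configuration on `E ⊕ F` is the product of the two marginal weights. -/
lemma weight_sum_type (p : E ⊕ F → R) (ω : Config E) (ωF : Config F) :
    weight p (Sum.elim ω ωF) = weight (p ∘ Sum.inl) ω * weight (p ∘ Sum.inr) ωF := by
  simp only [weight, Fintype.prod_sum_type, Sum.elim_inl, Sum.elim_inr, Function.comp_apply]

/-- **The marginal law**: the law of the `E`-edges of a product law on `E ⊕ F` is the product law
of their weights: `P_{p ∘ inl}(A) = P_p({ω | ω ∘ inl ∈ A})`. -/
theorem prob_comp_inl (p : E ⊕ F → R) (A : Set (Config E)) :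
    prob (p ∘ Sum.inl) A = prob p ((fun ω : Config (E ⊕ F) => ω ∘ Sum.inl) ⁻¹' A) := by
  classical
  unfold prob
  set e := Equiv.sumArrowEquivProdArrow E F Bool with he
  have key : ∑ ω' : Config (E ⊕ F),
      ((fun ω : Config (E ⊕ F) => ω ∘ Sum.inl) ⁻¹' A).indicator (weight p) ω' =
      ∑ x : Config E × Config F,
        ((fun ω : Config (E ⊕ F) => ω ∘ Sum.inl) ⁻¹' A).indicator (weight p) (e.symm x) :=
    (e.symm.sum_comp _).symm
  rw [key, Fintype.sum_prod_type]
  refine Finset.sum_congr rfl fun ω _ => ?_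
  have hsymm : ∀ ωF : Config F, e.symm (ω, ωF) = Sum.elim ω ωF := fun ωF => rfl
  have hinl : ∀ ωF : Config F, Sum.elim ω ωF ∘ Sum.inl = ω := fun ωF => by ext a; rfl
  by_cases h : ω ∈ A
  · have hmem : ∀ ωF : Config F,
        Sum.elim ω ωF ∈ (fun ω : Config (E ⊕ F) => ω ∘ Sum.inl) ⁻¹' A := fun ωF => by
      show Sum.elim ω ωF ∘ Sum.inl ∈ A
      rw [hinl]
      exact h
    rw [Set.indicator_of_mem h]
    calc weight (p ∘ Sum.inl) ω
        = ∑ ωF : Config F, weight (p ∘ Sum.inl) ω * weight (p ∘ Sum.inr) ωF := by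
          rw [← Finset.mul_sum, sum_weight, mul_one]
      _ = ∑ ωF : Config F, ((fun ω : Config (E ⊕ F) => ω ∘ Sum.inl) ⁻¹' A).indicator (weight p)
            (e.symm (ω, ωF)) := by
          refine Finset.sum_congr rfl fun ωF _ => ?_
          rw [hsymm, Set.indicator_of_mem (hmem ωF), weight_sum_type]
  · have hmem : ∀ ωF : Config F,
        Sum.elim ω ωF ∉ (fun ω : Config (E ⊕ F) => ω ∘ Sum.inl) ⁻¹' A := fun ωF => by
      show Sum.elim ω ωF ∘ Sum.inl ∉ A
      rw [hinl]
      exact h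
    rw [Set.indicator_of_notMem h]
    refine (Finset.sum_eq_zero fun ωF _ => ?_).symm
    rw [hsymm, Set.indicator_of_notMem (hmem ωF)]

end Marginal

/-! ## The leaf extension of a graph -/

section LeafExt

variable {V : Type*} {E : Type*}

/-- The graph `ends` with a new vertex `inr ()` hung on `z` by the new edge `inr ()`. -/
def leafExt (ends : E → Sym2 V) (z : V) : E ⊕ Unit → Sym2 (V ⊕ Unit)
  | Sum.inl e => (ends e).map Sum.inl
  | Sum.inr _ => s(Sum.inl z, Sum.inr ())

/-- The old edges of the leaf extension. -/
@[simp] lemma leafExt_inl (ends : E → Sym2 V) (z : V) (e : E) :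
    leafExt ends z (Sum.inl e) = (ends e).map Sum.inl := rfl

/-- The leaf edge of the leaf extension. -/
@[simp] lemma leafExt_inr (ends : E → Sym2 V) (z : V) (u : Unit) :
    leafExt ends z (Sum.inr u) = s(Sum.inl z, Sum.inr ()) := rfl

/-- The leaf has one edge. -/
lemma leafExt_leaf (ends : E → Sym2 V) (z : V) (f : E ⊕ Unit)
    (hf : Sum.inr () ∈ leafExt ends z f) : f = Sum.inr () := by
  rcases f with e | u
  · exfalso
    simp only [leafExt_inl, Sym2.mem_map] at hf
    obtain ⟨x, _, hx⟩ := hf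
    exact Sum.inl_ne_inr hx
  · rfl

/-- An open edge between two old vertices of the leaf extension is an old edge. -/
lemma openAdj_leafExt_inl_inl {ends : E → Sym2 V} {z : V} {ω : Config (E ⊕ Unit)} {u w : V} :
    OpenAdj (leafExt ends z) ω (Sum.inl u) (Sum.inl w) ↔ OpenAdj ends (ω ∘ Sum.inl) u w := by
  constructor
  · rintro ⟨f, hf, hends⟩
    rcases f with e | _
    · refine ⟨e, hf, ?_⟩
      rw [leafExt_inl, ← Sym2.map_mk] at hends
      exact Sym2.map.injective Sum.inl_injective hends
    · exfalso
      rw [leafExt_inr, Sym2.eq_iff] at hends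
      rcases hends with ⟨_, h⟩ | ⟨_, h⟩ <;> exact Sum.inr_ne_inl h
  · rintro ⟨e, he, hends⟩
    exact ⟨Sum.inl e, he, by rw [leafExt_inl, hends, Sym2.map_mk]⟩

/-- An open edge from an old vertex to the leaf is the leaf edge, at `z`. -/
lemma openAdj_leafExt_inl_inr {ends : E → Sym2 V} {z : V} {ω : Config (E ⊕ Unit)} {u : V} :
    OpenAdj (leafExt ends z) ω (Sum.inl u) (Sum.inr ()) ↔ ω (Sum.inr ()) = true ∧ u = z := by
  constructor
  · rintro ⟨f, hf, hends⟩
    rcases f with e | _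
    · exfalso
      have hmem : (Sum.inr () : V ⊕ Unit) ∈ leafExt ends z (Sum.inl e) := by
        rw [hends]; exact Sym2.mem_mk_right _ _
      rw [leafExt_inl, Sym2.mem_map] at hmem
      obtain ⟨x, _, hx⟩ := hmem
      exact Sum.inl_ne_inr hx
    · refine ⟨hf, ?_⟩
      rw [leafExt_inr, Sym2.eq_iff] at hends
      rcases hends with ⟨h, _⟩ | ⟨h, _⟩
      · exact (Sum.inl_injective h).symm
      · exact absurd h Sum.inl_ne_inr
  · rintro ⟨h, rfl⟩
    exact ⟨Sum.inr (), h, rfl⟩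

/-- **The leaf changes no connectivity among the old vertices.** -/
theorem conn_leafExt_iff (ends : E → Sym2 V) (z : V) (ω : Config (E ⊕ Unit)) (x x' : V) :
    Conn ends (ω ∘ Sum.inl) x x' ↔ Conn (leafExt ends z) ω (Sum.inl x) (Sum.inl x') := by
  constructor
  · intro h
    refine mem_of_conn_of_closed (S := {u : V | Conn (leafExt ends z) ω (Sum.inl x) (Sum.inl u)})
      ?_ (conn_refl _ _ _) h
    intro u hu w hadj
    rw [openGraph_adj] at hadj
    exact conn_trans hu (conn_of_openAdj (openAdj_leafExt_inl_inl.2 hadj.2))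
  · intro h
    let S : Set (V ⊕ Unit) := {w | (∃ u, w = Sum.inl u ∧ Conn ends (ω ∘ Sum.inl) x u) ∨
      (w = Sum.inr () ∧ Conn ends (ω ∘ Sum.inl) x z)}
    have hS : ∀ w ∈ S, ∀ w', (openGraph (leafExt ends z) ω).Adj w w' → w' ∈ S := by
      intro w hw w' hadj
      rw [openGraph_adj] at hadj
      obtain ⟨hne, hadj⟩ := hadj
      rcases hw with ⟨u, rfl, hu⟩ | ⟨rfl, hz⟩
      · rcases w' with u' | _
        · exact Or.inl ⟨u', rfl, conn_trans hu (conn_of_openAdj (openAdj_leafExt_inl_inl.1 hadj))⟩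
        · obtain ⟨_, rfl⟩ := openAdj_leafExt_inl_inr.1 hadj
          exact Or.inr ⟨rfl, hu⟩
      · rcases w' with u' | _
        · obtain ⟨_, rfl⟩ := openAdj_leafExt_inl_inr.1 hadj.symm
          exact Or.inl ⟨u', rfl, hz⟩
        · exact absurd rfl hne
    have hx : Sum.inl x ∈ S := Or.inl ⟨x, rfl, conn_refl _ _ _⟩
    have hx' := mem_of_conn_of_closed hS hx h
    rcases hx' with ⟨u, hu, hconn⟩ | ⟨h', _⟩
    · rw [← Sum.inl_injective hu] at hconn
      exact hconn
    · exact absurd h' Sum.inl_ne_inr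

end LeafExt

/-! ## Transport to the leaf extension, and the pendant step -/

section Main

variable {V : Type*} {E : Type*} [Fintype E] [DecidableEq E] [Fintype V] [DecidableEq V]
  {R : Type*} [Field R] [LinearOrder R] [IsStrictOrderedRing R]

omit [Fintype E] [Field R] [LinearOrder R] [IsStrictOrderedRing R] in
/-- The old weights of a weight vector with the leaf edge pinned. -/
lemma update_inr_comp_inl (p : E ⊕ Unit → R) (c : R) :
    Function.update p (Sum.inr ()) c ∘ Sum.inl = p ∘ Sum.inl := by
  ext e
  simp only [Function.comp_apply]
  exact Function.update_of_ne Sum.inl_ne_inr _ _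

omit [Fintype V] [IsStrictOrderedRing R] in
/-- `(K′)` transports to the leaf extension (old marks). -/
theorem kprimeHolds_leafExt (ends : E → Sym2 V) (z : V) (p : E ⊕ Unit → R) (a₁ a₂ b v y : V) :
    KPrime.KPrimeHolds ends a₁ a₂ b v y (p ∘ Sum.inl) ↔
      KPrime.KPrimeHolds (leafExt ends z) (Sum.inl a₁) (Sum.inl a₂) (Sum.inl b) (Sum.inl v)
        (Sum.inl y) p :=
  kprimeHolds_transport' (fun A => prob_comp_inl p A)
    (fun ω x x' => conn_leafExt_iff ends z ω x x') a₁ a₂ b v y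

omit [Fintype V] [IsStrictOrderedRing R] in
/-- `(K′-T)` transports to the leaf extension (old marks). -/
theorem kprimeTHolds_leafExt (ends : E → Sym2 V) (z : V) (p : E ⊕ Unit → R) (a₁ a₂ b v y : V) :
    KPrime.KPrimeTHolds ends a₁ a₂ b v y (p ∘ Sum.inl) ↔
      KPrime.KPrimeTHolds (leafExt ends z) (Sum.inl a₁) (Sum.inl a₂) (Sum.inl b) (Sum.inl v)
        (Sum.inl y) p :=
  kprimeTHolds_transport' (fun A => prob_comp_inl p A)
    (fun ω x x' => conn_leafExt_iff ends z ω x x') a₁ a₂ b v y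

/-- **Hanging `v` on a leaf**: if `(K′)` and `(K′-T)` hold on `ends` at `(a₁, a₂, b, z, y)` for
the weights of the old edges, then `(K′)` holds on the leaf extension at `z` with `v` the leaf, for
every weight of the leaf edge `≠ 1` (the three masses of the `z`-instance positive) — mine-c g34's
pendant step `kprime_of_pendant_T` fed by the transports. -/
theorem kprime_leafExt (ends : E → Sym2 V) (z a₁ a₂ b y : V) (p : E ⊕ Unit → R)
    (hp : IsProbVec p) (he : p (Sum.inr ()) ≠ 1)
    (H1 : KPrime.KPrimeHolds ends a₁ a₂ b z y (p ∘ Sum.inl))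
    (H2 : KPrime.KPrimeTHolds ends a₁ a₂ b z y (p ∘ Sum.inl))
    (hO : 0 < prob (Function.update p (Sum.inr ()) 0)
      (KPrime.Ω (leafExt ends z) (Sum.inl a₁) (Sum.inl a₂)))
    (hNz : 0 < prob (Function.update p (Sum.inr ()) 0)
      (KPrime.N (leafExt ends z) (Sum.inl a₁) (Sum.inl a₂) (Sum.inl z)))
    (hSz : 0 < prob (Function.update p (Sum.inr ()) 0)
      (KPrime.S (leafExt ends z) (Sum.inl a₁) (Sum.inl a₂) (Sum.inl z))) :
    KPrime.KPrimeHolds (leafExt ends z) (Sum.inl a₁) (Sum.inl a₂) (Sum.inl b) (Sum.inr ())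
      (Sum.inl y) p := by
  have H1' : KPrime.KPrimeHolds (leafExt ends z) (Sum.inl a₁) (Sum.inl a₂) (Sum.inl b) (Sum.inl z)
      (Sum.inl y) (Function.update p (Sum.inr ()) 0) := by
    rw [← kprimeHolds_leafExt, update_inr_comp_inl]
    exact H1
  have H2' : KPrime.KPrimeTHolds (leafExt ends z) (Sum.inl a₁) (Sum.inl a₂) (Sum.inl b)
      (Sum.inl z) (Sum.inl y) (Function.update p (Sum.inr ()) 0) := by
    rw [← kprimeTHolds_leafExt, update_inr_comp_inl]
    exact H2
  exact KPrime.kprime_of_pendant_T hp (leafExt_leaf ends z) (by rw [leafExt_inr, Sym2.eq_swap]) he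
    Sum.inr_ne_inl Sum.inl_ne_inr Sum.inl_ne_inr Sum.inl_ne_inr Sum.inl_ne_inr hO hNz hSz H1' H2'

end Main

/-! ## Cycles and necklaces with `v` on a leaf -/

section Families

variable {R : Type*} [Field R] [LinearOrder R] [IsStrictOrderedRing R]

/-- **`(K′)` on the `n`-cycle with `v` hung by a leaf edge on an unmarked vertex `z`**, for every
admissible weight vector with the leaf weight `≠ 1` and the three masses of the `z`-instance
positive (`kprime_cycle`, `kprimeT_cycle`, `kprime_leafExt`). -/
theorem kprime_cycle_leaf {n : ℕ} [NeZero n] (z a₁ a₂ b y : Fin n) (p : Fin n ⊕ Unit → R)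
    (hp : IsProbVec p) (he : p (Sum.inr ()) ≠ 1) (h12 : a₁ ≠ a₂) (h1b : a₁ ≠ b) (h1z : a₁ ≠ z)
    (h1y : a₁ ≠ y) (h2b : a₂ ≠ b) (h2z : a₂ ≠ z) (h2y : a₂ ≠ y) (hbz : b ≠ z) (hby : b ≠ y)
    (hzy : z ≠ y)
    (hO : 0 < prob (Function.update p (Sum.inr ()) 0)
      (KPrime.Ω (leafExt (cycN n) z) (Sum.inl a₁) (Sum.inl a₂)))
    (hNz : 0 < prob (Function.update p (Sum.inr ()) 0)
      (KPrime.N (leafExt (cycN n) z) (Sum.inl a₁) (Sum.inl a₂) (Sum.inl z)))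
    (hSz : 0 < prob (Function.update p (Sum.inr ()) 0)
      (KPrime.S (leafExt (cycN n) z) (Sum.inl a₁) (Sum.inl a₂) (Sum.inl z))) :
    KPrime.KPrimeHolds (leafExt (cycN n) z) (Sum.inl a₁) (Sum.inl a₂) (Sum.inl b) (Sum.inr ())
      (Sum.inl y) p := by
  have hp' : IsProbVec (p ∘ Sum.inl) := ⟨fun e => hp.nonneg _, fun e => hp.le_one _⟩
  exact kprime_leafExt (cycN n) z a₁ a₂ b y p hp he
    (kprime_cycle (p ∘ Sum.inl) hp' a₁ a₂ b z y h12 h1b h1z h1y h2b h2z h2y hbz hby hzy)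
    (kprimeT_cycle (p ∘ Sum.inl) hp' a₁ a₂ b z y h12 h1b h1z h1y h2b h2z h2y hbz hby hzy)
    hO hNz hSz

variable {V : Type*} {E : Type*} [Fintype E] [DecidableEq E] [Fintype V] [DecidableEq V]
variable {ends : E → Sym2 V} {q : Fin 5 → V} {blk : E → Fin 5} {Vj : Fin 5 → Set V}

/-- **`(K′)` on a necklace with `v` hung by a leaf edge on its fifth mark `q kz`**, for every
admissible weight vector with the leaf weight `≠ 1` and the three masses of the `z`-instance
positive (`kprime_necklace`, `kprimeT_necklace`, `kprime_leafExt`). -/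
theorem kprime_necklace_leaf (hN : IsNecklace ends q blk Vj) (kz k₁ k₂ kb ky : Fin 5)
    (p : E ⊕ Unit → R) (hp : IsProbVec p) (he : p (Sum.inr ()) ≠ 1) (h12 : k₁ ≠ k₂)
    (h1b : k₁ ≠ kb) (h1z : k₁ ≠ kz) (h1y : k₁ ≠ ky) (h2b : k₂ ≠ kb) (h2z : k₂ ≠ kz) (h2y : k₂ ≠ ky)
    (hbz : kb ≠ kz) (hby : kb ≠ ky) (hzy : kz ≠ ky)
    (hO : 0 < prob (Function.update p (Sum.inr ()) 0)
      (KPrime.Ω (leafExt ends (q kz)) (Sum.inl (q k₁)) (Sum.inl (q k₂))))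
    (hNz : 0 < prob (Function.update p (Sum.inr ()) 0)
      (KPrime.N (leafExt ends (q kz)) (Sum.inl (q k₁)) (Sum.inl (q k₂)) (Sum.inl (q kz))))
    (hSz : 0 < prob (Function.update p (Sum.inr ()) 0)
      (KPrime.S (leafExt ends (q kz)) (Sum.inl (q k₁)) (Sum.inl (q k₂)) (Sum.inl (q kz)))) :
    KPrime.KPrimeHolds (leafExt ends (q kz)) (Sum.inl (q k₁)) (Sum.inl (q k₂)) (Sum.inl (q kb))
      (Sum.inr ()) (Sum.inl (q ky)) p := by
  have hp' : IsProbVec (p ∘ Sum.inl) := ⟨fun e => hp.nonneg _, fun e => hp.le_one _⟩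
  exact kprime_leafExt ends (q kz) (q k₁) (q k₂) (q kb) (q ky) p hp he
    (kprime_necklace hN (p ∘ Sum.inl) hp' k₁ k₂ kb kz ky h12 h1b h1z h1y h2b h2z h2y hbz hby hzy)
    (kprimeT_necklace hN (p ∘ Sum.inl) hp' k₁ k₂ kb kz ky h12 h1b h1z h1y h2b h2z h2y hbz hby hzy)
    hO hNz hSz

end Families

end KPrimeCycle

end Summit.Ventures.PercRepro2
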